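import Summits.NavierStokesRegularity.NavierStokesRegularity.Theses.AxisymmetricExtremality
import Summits.NavierStokesRegularity.NavierStokesRegularity.Theorems.AxisymmetricLiouvilleBoundedSwirl
import Literature.Analysis.FluidPDE.SelfSimilar
import Literature.Analysis.FluidPDE.AxisymmetricEuler
import HarnessLib

/-!
# Strategist s16-g6 — typed companion of the independent strategy census (family `s`, gen 6)
# for the crux `AxisymmetricExtremality.AxisymmetricKatoGlobal` (stmt-NavierStokesRegularity-15453)

Statement-only objects (no `sorry`) certifying the census entries:

* §1 WEAKER INTERMEDIATE. `WMin` = the weakest statement the route's deciding theorem `closes`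
  admits in place of the crux: the THRESHOLD INSTANCE with the Clay-failure antecedent in scope.
  `closes_of_wMin` re-glues the route through it (pure logic); `wMin_of_crux` (crux ⇒ WMin) and
  `wMin_of_summit` (S ⇒ WMin, by vacuity) show WMin is a consequence of both — it is the exact
  residual content `closes` consumes, and nothing weaker is admissible.
* §2 DECOMPOSITION D8 (KNSS Liouville programme made explicit, KNSS 2009 arXiv p. 11):
  `crux ⇐ AxisymmetricLiouvilleBoundedSwirl ∧ PlanarLiouville ∧ NonDegenerateZoom`
  (`crux_of_liouville_zoom`, pure logic). The Liouville piece is the CANONICAL in-tree open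
  conjecture `Summit.NavierStokesRegularity.NavierStokesRegularity.AxisymmetricLiouvilleBoundedSwirl`
  (KNSS 2009 §5, open); `PlanarLiouville` is the known 2.5-D case (KNSS 2009 Thm 6.2 proof,
  arXiv p. 13); `NonDegenerateZoom` carries the Type-II degeneracy (constant zoom limits).
* §3 STRENGTHEN. `CruxL3` (drop the `Ḣ^{1/2}` representative) ⇒ crux (`crux_of_cruxL3`).
* §4 NEGATION. `not_crux_iff`: the negation is an axisymmetric critical datum without a global
  Kato solution (what a counterexample must be).
-/

noncomputable section

open MeasureTheory Set Function Filter

namespace Summit.NavierStokesRegularity.NavierStokesRegularity.Cruxes.AxisymmetricKatoGlobal.StrategistS16g6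

open Literature.Analysis Literature.Analysis.FluidPDE
open Summit.NavierStokesRegularity.NavierStokesRegularity.Theses.AxisymmetricExtremality

/-! ## §0 The two clauses shared by all objects -/

/-- Clay (A) FAILS at viscosity `ν` — verbatim the antecedent of `MinimalDatumPFold` (and the
negation of the summit's conclusion at `ν`). -/
def ClayFailsAt (ν : ℝ) : Prop :=
  ∃ v₀ : EuclideanSpace ℝ (Fin 3) → EuclideanSpace ℝ (Fin 3), ContDiff ℝ (⊤ : ℕ∞) v₀ ∧
    Literature.Analysis.FluidPDE.NSWave0.IsDivFree v₀ ∧ Literature.Analysis.FluidPDE.HasRapidSpatialDecay v₀ ∧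
    ¬ ∃ (u : ℝ → EuclideanSpace ℝ (Fin 3) → EuclideanSpace ℝ (Fin 3)) (p : ℝ → EuclideanSpace ℝ (Fin 3) → ℝ),
      Literature.Analysis.FluidPDE.IsSmoothOnHalfSpace u ∧ Literature.Analysis.FluidPDE.IsSmoothOnHalfSpace p ∧
      Literature.Analysis.FluidPDE.IsNavierStokesSolution ν 0 v₀ u p ∧ Literature.Analysis.FluidPDE.HasBoundedEnergy u

/-- The crux's axisymmetry clause, verbatim (`= IsAxisymmetric u₀` unfolded, `Iff.rfl`). -/
def AxisymClause (u₀ : EuclideanSpace ℝ (Fin 3) → EuclideanSpace ℝ (Fin 3)) : Prop :=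
  ∀ (θ : ℝ) (x : EuclideanSpace ℝ (Fin 3)),
    u₀ (WithLp.toLp 2 ![Real.cos θ * x 0 - Real.sin θ * x 1, Real.sin θ * x 0 + Real.cos θ * x 1, x 2]) =
      WithLp.toLp 2 ![Real.cos θ * u₀ x 0 - Real.sin θ * u₀ x 1, Real.sin θ * u₀ x 0 + Real.cos θ * u₀ x 1, u₀ x 2]

theorem axisymClause_iff (u₀ : EuclideanSpace ℝ (Fin 3) → EuclideanSpace ℝ (Fin 3)) :
    AxisymClause u₀ ↔ IsAxisymmetric u₀ := Iff.rfl

/-! ## §1 Weaker intermediate: the threshold instance `WMin` -/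

/-- **W_min** — the weakest replacement of the crux that `closes` admits: for every `ν > 0` at
which Clay (A) fails, there is NO axisymmetric `Ḣ^{1/2}`-minimal blow-up datum (Rusin–Šverák set
`M`). Equivalently: given Clay failure, `ρ_ax(ν) > ρ_max^pure(ν)` or axisymmetric data never blow
up at the threshold. -/
def WMin : Prop :=
  ∀ ν : ℝ, 0 < ν → ClayFailsAt ν →
    ∀ (u₀ : EuclideanSpace ℝ (Fin 3) → EuclideanSpace ℝ (Fin 3))
      (g : Literature.Analysis.FunctionSpaces.HomSobolev (EuclideanSpace ℝ (Fin 3)) (EuclideanSpace ℂ (Fin 3)) (1 / 2 : ℝ)),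
      IsMinimalBlowupDatum ν u₀ g → AxisymClause u₀ → False

/-- The route re-glued through `WMin` (pure logic, same proof shape as `closes`). -/
theorem closes_of_wMin (h₂ : MinimalDatumPFold) (h₄ : PFoldToAxisymmetric) (hW : WMin) :
    _root_.NavierStokesRegularity := by
  show Literature.NS.NavierStokesExistenceSmoothR3
  intro ν hν u₀ hsm hdiv hdec
  by_contra hno
  have hfail : ClayFailsAt ν := ⟨u₀, hsm, hdiv, hdec, hno⟩
  obtain ⟨u₁, g, hmin, hax⟩ := h₄ ν hν (h₂ ν hν hfail)
  exact hW ν hν hfail u₁ g hmin hax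

/-- crux ⇒ W_min (W_min is weaker than the crux). -/
theorem wMin_of_crux (h : AxisymmetricKatoGlobal) : WMin := by
  intro ν hν _ u₀ g hmin hax
  obtain ⟨hL3, hrep, hdiv, -, hnot⟩ := hmin
  exact hnot (h ν hν u₀ g hL3 hrep hdiv hax)

/-- S ⇒ W_min by VACUITY (the Clay-failure antecedent contradicts S): W_min is a consequence of
the summit, i.e. exactly the residual content of the route at this node — not a strictly easier
target with a tool of its own. -/
theorem wMin_of_summit (h : _root_.NavierStokesRegularity) : WMin := by
  intro ν hν hfail _ _ _ _
  obtain ⟨v₀, hsm, hdiv, hdec, hno⟩ := hfail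
  have hS : Literature.NS.NavierStokesExistenceSmoothR3 := h
  exact hno (hS ν hν v₀ hsm hdiv hdec)

/-! ## §2 Decomposition D8: Liouville ∧ non-degenerate zoom -/

/-- **PlanarLiouville** (KNOWN in print, not yet in tree in this form; KNSS 2009, proof of Thm 6.2,
arXiv p. 13: "w is independent of the x₂-variable. Applying Theorem (2D) … (w₁,w₃) must [be
constant]" + Liouville for the heat equation with constant drift for the third component): a
bounded ancient mild solution on `ℝ³` invariant under translations along `e₀` is slice-wise
a.e. constant. The far-axis branch of every zoom at an axis singularity. [difficulty: M] -/
def PlanarLiouville : Prop :=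
  ∀ U : ℝ → EuclideanSpace ℝ (Fin 3) → EuclideanSpace ℝ (Fin 3), IsBoundedAncientMildSolution 1 U →
    (∀ t < 0, AEStronglyMeasurable (U t) volume) →
      (∀ t < 0, ∀ (x : EuclideanSpace ℝ (Fin 3)) (s : ℝ), U t (x + s • EuclideanSpace.single 0 1) = U t x) →
        ∀ t < 0, ∃ b : EuclideanSpace ℝ (Fin 3), U t =ᵐ[volume] fun _ => b

/-- **NonDegenerateZoom** (OPEN, no tool — the Type-II degeneracy): if an axisymmetric critical
datum has no global Kato solution, SOME rescaling sequence at the (axis, Type II) singularity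
converges to a bounded ancient mild solution (`ν = 1` by scaling) which is NOT slice-wise constant,
and which is either axisymmetric about the `x₂`-axis with bounded swirl `Γ` (near-axis branch,
after a horizontal translation; `Γ` is scale-invariant and locally bounded by Seregin–Šverák 2009
Lemma 3.3) or invariant along `e₀` (far-axis branch, after a rotation). KNSS 2009 Prop 6.1 gives
such a limit with `|U(0,0)| = 1` — non-ZERO, but possibly CONSTANT (`c·e_z`); excluding constants
needs a scale-invariant quantity surviving the limit, available only under Type I (KNSS Thm 6.2)
— excluded here by Seregin 2020 Thm 2.1. -/
def NonDegenerateZoom : Prop :=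
  ∀ ν : ℝ, 0 < ν → ∀ (u₀ : EuclideanSpace ℝ (Fin 3) → EuclideanSpace ℝ (Fin 3))
    (g : Literature.Analysis.FunctionSpaces.HomSobolev (EuclideanSpace ℝ (Fin 3)) (EuclideanSpace ℂ (Fin 3)) (1 / 2 : ℝ)),
    MemLp u₀ 3 volume → g.Represents (Literature.Analysis.FunctionSpaces.EuclideanSpace.complexify ∘ u₀) →
    IsWeaklyDivFree u₀ → IsAxisymmetric u₀ → ¬ HasGlobalKatoSolution ν u₀ →
      ∃ U : ℝ → EuclideanSpace ℝ (Fin 3) → EuclideanSpace ℝ (Fin 3),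
        IsBoundedAncientMildSolution 1 U ∧ (∀ t < 0, AEStronglyMeasurable (U t) volume) ∧
        (((∀ t < 0, IsAxisymmetric (U t)) ∧ ∃ C : ℝ, ∀ t < 0, ∀ x, |swirl (U t) x| ≤ C) ∨
          (∀ t < 0, ∀ (x : EuclideanSpace ℝ (Fin 3)) (s : ℝ), U t (x + s • EuclideanSpace.single 0 1) = U t x)) ∧
        ¬ (∀ t < 0, ∃ b : EuclideanSpace ℝ (Fin 3), U t =ᵐ[volume] fun _ => b)

/-- **D8 assembly** (kernel-checked, pure logic): the canonical open conjecture AX-L, the known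
planar Liouville theorem and the non-degenerate zoom imply the crux BY NAME. -/
theorem crux_of_liouville_zoom
    (hL : Summit.NavierStokesRegularity.NavierStokesRegularity.AxisymmetricLiouvilleBoundedSwirl)
    (hP : PlanarLiouville) (hZ : NonDegenerateZoom) : AxisymmetricKatoGlobal := by
  intro ν hν u₀ g h3 hrep hdiv hax
  by_contra hno
  obtain ⟨U, hU, hmeas, hcase, hnc⟩ := hZ ν hν u₀ g h3 hrep hdiv (fun θ x => hax θ x) hno
  rcases hcase with ⟨hsym, hΓ⟩ | hpl
  · exact hnc (hL U hU hmeas hsym hΓ)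
  · exact hnc (hP U hU hmeas hpl)

/-- Conversely the zoom piece is implied by the crux VACUOUSLY (its antecedent `¬ HasGlobalKato…`
is what the crux denies): it is weaker than the crux and used toward it — admissible as a piece,
but it carries no independent evidence. -/
theorem nonDegenerateZoom_of_crux (h : AxisymmetricKatoGlobal) : NonDegenerateZoom := by
  intro ν hν u₀ g h3 hrep hdiv hax hno
  exact (hno (h ν hν u₀ g h3 hrep hdiv (fun θ x => hax θ x))).elim

/-! ## §3 Strengthen: drop the `Ḣ^{1/2}` representative -/

/-- **S⁺ = CruxL3**: every weakly divergence-free axisymmetric `u₀ ∈ L³` has a global Kato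
solution (no `Ḣ^{1/2}` representative). Strictly more data; same tools. -/
def CruxL3 : Prop :=
  ∀ ν : ℝ, 0 < ν → ∀ u₀ : EuclideanSpace ℝ (Fin 3) → EuclideanSpace ℝ (Fin 3),
    MemLp u₀ 3 volume → IsWeaklyDivFree u₀ → IsAxisymmetric u₀ → HasGlobalKatoSolution ν u₀

theorem crux_of_cruxL3 (h : CruxL3) : AxisymmetricKatoGlobal :=
  fun ν hν u₀ _ h3 _ hdiv hax => h ν hν u₀ h3 hdiv (fun θ x => hax θ x)

/-! ## §4 Negation: what a counterexample is -/

/-- `¬ crux` unfolded: an axisymmetric critical datum (`L³`, represented in `Ḣ^{1/2}`, weakly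
divergence-free) WITHOUT a global Kato solution at some `ν > 0` (by `Disproof.crux_iff_nu_one`,
WLOG `ν = 1`); by the landed `stub_katoAxisymSingularPoint` and Seregin 2020 Thm 2.1 its first
singularity is an axis point of Type II in the scaled-energy sense. -/
theorem not_crux_iff :
    ¬ AxisymmetricKatoGlobal ↔
      ∃ ν : ℝ, 0 < ν ∧ ∃ (u₀ : EuclideanSpace ℝ (Fin 3) → EuclideanSpace ℝ (Fin 3))
        (g : Literature.Analysis.FunctionSpaces.HomSobolev (EuclideanSpace ℝ (Fin 3)) (EuclideanSpace ℂ (Fin 3)) (1 / 2 : ℝ)),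
        MemLp u₀ 3 volume ∧ g.Represents (Literature.Analysis.FunctionSpaces.EuclideanSpace.complexify ∘ u₀) ∧
        IsWeaklyDivFree u₀ ∧ AxisymClause u₀ ∧ ¬ HasGlobalKatoSolution ν u₀ := by
  constructor
  · intro h
    by_contra hne
    apply h
    intro ν hν u₀ g h3 hrep hdiv hax
    by_contra hno
    exact hne ⟨ν, hν, u₀, g, h3, hrep, hdiv, hax, hno⟩
  · rintro ⟨ν, hν, u₀, g, h3, hrep, hdiv, hax, hno⟩ h
    exact hno (h ν hν u₀ g h3 hrep hdiv hax)

end Summit.NavierStokesRegularity.NavierStokesRegularity.Cruxes.AxisymmetricKatoGlobal.StrategistS16g6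

end
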